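import Summits.Ventures.WeilGRH.UniformConductorFloorCoprimeData
import Summits.Ventures.WeilGRH.UniformConductorFloorCellsOne
import Summits.Ventures.WeilGRH.UniformConductorFloorRungs
import HarnessLib

/-!
# GRH arm (rh-explicit, venture WeilGRH): divisibility floors — the transcendental inputs of the level-`m` certificates

Cell `rh-explicit`, WEIL TRACK — GRH ARM (weil-grh-1, gen7 «divisibility floors»).  For the six joint cell certificates
`certEvenDvd2` … `certOddDvd6` of `UniformConductorFloorCoprimeData.lean` (level `m ∈ {2, 3, 6}`, window `t = 320 log(320/319) ≥ 1`):
the weight bounds `Λ(n)/√n ≤ W_n/2^20` on the prime powers `n ≤ 7` PRIME TO `m` (`UniformFloor.wbar7_ge`; the other weights are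
`0`, which is all `JointCert.weilPositivityOnChar_one_of_parts_coprime` asks), the elementary logarithm bounds
`log 34 ≥ 2 log 2 + 2 log 3 − 1/17`, `log 14 ≥ 4 log 2 − 1/7`, `log 45 ≥ 4 log 2 + log 3 − 1/15`, `log 24 = 3 log 2 + log 3`
(`log 18`, `log 12` inline; cf. `FordLambda.log_18_eq` / `log_12_eq`), and the six budget inequalities `log π − ψ₀ − Clow/D + RHO/D ≤ log Q₀` with
`Q₀ = 34 / 14` (`m = 2`), `45 / 18` (`m = 3`), `24 / 12` (`m = 6`) (`ψ₀` = the tree's `psi_even_ge` / `psi_odd_ge` constants,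
`log π ≤ 1.1447299`).  Consumed by `UniformConductorFloorCoprimeFloors.lean`.  No definitions; no named facts; standard axioms.
[folklore]
-/

noncomputable section

open Real Set
open scoped ArithmeticFunction.vonMangoldt

namespace Summit.Ventures.WeilGRH

open Literature.NumberTheory.LFunctions

namespace UniformFloor

/-! ## The transcendental inputs -/

/-- The weights of `certEvenDvd2` dominate `Λ(n)/√n` on the `n ≤ 7` prime to `2` (`W_n = ⌈2^20 w̄_n⌉`, `UniformFloor.wbar7_ge`);
the other weights are `0`. [folklore] -/
theorem certEvenDvd2_hw : ∀ n ∈ Finset.range (certEvenDvd2.N + 1),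
    (if n.Coprime 2 then (Λ n : ℝ) / Real.sqrt n else 0) ≤ certEvenDvd2.wbar n := by
  intro n hn
  have hn8 : n < 8 := by simpa [show certEvenDvd2.N = 7 from rfl] using Finset.mem_range.1 hn
  have hw := wbar7_ge 7 le_rfl n (Finset.mem_range.2 hn8)
  unfold JointCert.wbar
  rw [show certEvenDvd2.D = 1048576 from rfl]
  interval_cases n
  · rw [if_neg (by decide), show certEvenDvd2.weights.getD 0 0 = 0 from rfl]
    norm_num
  · rw [if_pos (by decide), show certEvenDvd2.weights.getD 1 0 = 0 from rfl]
    exact hw.trans (by norm_num [wbar7])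
  · rw [if_neg (by decide), show certEvenDvd2.weights.getD 2 0 = 0 from rfl]
    norm_num
  · rw [if_pos (by decide), show certEvenDvd2.weights.getD 3 0 = 665112 from rfl]
    exact hw.trans (by norm_num [wbar7])
  · rw [if_neg (by decide), show certEvenDvd2.weights.getD 4 0 = 0 from rfl]
    norm_num
  · rw [if_pos (by decide), show certEvenDvd2.weights.getD 5 0 = 754726 from rfl]
    exact hw.trans (by norm_num [wbar7])
  · rw [if_neg (by decide), show certEvenDvd2.weights.getD 6 0 = 0 from rfl]
    norm_num
  · rw [if_pos (by decide), show certEvenDvd2.weights.getD 7 0 = 771213 from rfl]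
    exact hw.trans (by norm_num [wbar7])

/-- The weights of `certOddDvd2` dominate `Λ(n)/√n` on the `n ≤ 7` prime to `2` (`W_n = ⌈2^20 w̄_n⌉`, `UniformFloor.wbar7_ge`);
the other weights are `0`. [folklore] -/
theorem certOddDvd2_hw : ∀ n ∈ Finset.range (certOddDvd2.N + 1),
    (if n.Coprime 2 then (Λ n : ℝ) / Real.sqrt n else 0) ≤ certOddDvd2.wbar n := by
  intro n hn
  have hn8 : n < 8 := by simpa [show certOddDvd2.N = 7 from rfl] using Finset.mem_range.1 hn
  have hw := wbar7_ge 7 le_rfl n (Finset.mem_range.2 hn8)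
  unfold JointCert.wbar
  rw [show certOddDvd2.D = 1048576 from rfl]
  interval_cases n
  · rw [if_neg (by decide), show certOddDvd2.weights.getD 0 0 = 0 from rfl]
    norm_num
  · rw [if_pos (by decide), show certOddDvd2.weights.getD 1 0 = 0 from rfl]
    exact hw.trans (by norm_num [wbar7])
  · rw [if_neg (by decide), show certOddDvd2.weights.getD 2 0 = 0 from rfl]
    norm_num
  · rw [if_pos (by decide), show certOddDvd2.weights.getD 3 0 = 665112 from rfl]
    exact hw.trans (by norm_num [wbar7])
  · rw [if_neg (by decide), show certOddDvd2.weights.getD 4 0 = 0 from rfl]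
    norm_num
  · rw [if_pos (by decide), show certOddDvd2.weights.getD 5 0 = 754726 from rfl]
    exact hw.trans (by norm_num [wbar7])
  · rw [if_neg (by decide), show certOddDvd2.weights.getD 6 0 = 0 from rfl]
    norm_num
  · rw [if_pos (by decide), show certOddDvd2.weights.getD 7 0 = 771213 from rfl]
    exact hw.trans (by norm_num [wbar7])

/-- The weights of `certEvenDvd3` dominate `Λ(n)/√n` on the `n ≤ 7` prime to `3` (`W_n = ⌈2^20 w̄_n⌉`, `UniformFloor.wbar7_ge`);
the other weights are `0`. [folklore] -/
theorem certEvenDvd3_hw : ∀ n ∈ Finset.range (certEvenDvd3.N + 1),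
    (if n.Coprime 3 then (Λ n : ℝ) / Real.sqrt n else 0) ≤ certEvenDvd3.wbar n := by
  intro n hn
  have hn8 : n < 8 := by simpa [show certEvenDvd3.N = 7 from rfl] using Finset.mem_range.1 hn
  have hw := wbar7_ge 7 le_rfl n (Finset.mem_range.2 hn8)
  unfold JointCert.wbar
  rw [show certEvenDvd3.D = 1048576 from rfl]
  interval_cases n
  · rw [if_neg (by decide), show certEvenDvd3.weights.getD 0 0 = 0 from rfl]
    norm_num
  · rw [if_pos (by decide), show certEvenDvd3.weights.getD 1 0 = 0 from rfl]
    exact hw.trans (by norm_num [wbar7])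
  · rw [if_pos (by decide), show certEvenDvd3.weights.getD 2 0 = 513950 from rfl]
    exact hw.trans (by norm_num [wbar7])
  · rw [if_neg (by decide), show certEvenDvd3.weights.getD 3 0 = 0 from rfl]
    norm_num
  · rw [if_pos (by decide), show certEvenDvd3.weights.getD 4 0 = 363409 from rfl]
    exact hw.trans (by norm_num [wbar7])
  · rw [if_pos (by decide), show certEvenDvd3.weights.getD 5 0 = 754726 from rfl]
    exact hw.trans (by norm_num [wbar7])
  · rw [if_neg (by decide), show certEvenDvd3.weights.getD 6 0 = 0 from rfl]
    norm_num
  · rw [if_pos (by decide), show certEvenDvd3.weights.getD 7 0 = 771213 from rfl]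
    exact hw.trans (by norm_num [wbar7])

/-- The weights of `certOddDvd3` dominate `Λ(n)/√n` on the `n ≤ 7` prime to `3` (`W_n = ⌈2^20 w̄_n⌉`, `UniformFloor.wbar7_ge`);
the other weights are `0`. [folklore] -/
theorem certOddDvd3_hw : ∀ n ∈ Finset.range (certOddDvd3.N + 1),
    (if n.Coprime 3 then (Λ n : ℝ) / Real.sqrt n else 0) ≤ certOddDvd3.wbar n := by
  intro n hn
  have hn8 : n < 8 := by simpa [show certOddDvd3.N = 7 from rfl] using Finset.mem_range.1 hn
  have hw := wbar7_ge 7 le_rfl n (Finset.mem_range.2 hn8)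
  unfold JointCert.wbar
  rw [show certOddDvd3.D = 1048576 from rfl]
  interval_cases n
  · rw [if_neg (by decide), show certOddDvd3.weights.getD 0 0 = 0 from rfl]
    norm_num
  · rw [if_pos (by decide), show certOddDvd3.weights.getD 1 0 = 0 from rfl]
    exact hw.trans (by norm_num [wbar7])
  · rw [if_pos (by decide), show certOddDvd3.weights.getD 2 0 = 513950 from rfl]
    exact hw.trans (by norm_num [wbar7])
  · rw [if_neg (by decide), show certOddDvd3.weights.getD 3 0 = 0 from rfl]
    norm_num
  · rw [if_pos (by decide), show certOddDvd3.weights.getD 4 0 = 363409 from rfl]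
    exact hw.trans (by norm_num [wbar7])
  · rw [if_pos (by decide), show certOddDvd3.weights.getD 5 0 = 754726 from rfl]
    exact hw.trans (by norm_num [wbar7])
  · rw [if_neg (by decide), show certOddDvd3.weights.getD 6 0 = 0 from rfl]
    norm_num
  · rw [if_pos (by decide), show certOddDvd3.weights.getD 7 0 = 771213 from rfl]
    exact hw.trans (by norm_num [wbar7])

/-- The weights of `certEvenDvd6` dominate `Λ(n)/√n` on the `n ≤ 7` prime to `6` (`W_n = ⌈2^20 w̄_n⌉`, `UniformFloor.wbar7_ge`);
the other weights are `0`. [folklore] -/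
theorem certEvenDvd6_hw : ∀ n ∈ Finset.range (certEvenDvd6.N + 1),
    (if n.Coprime 6 then (Λ n : ℝ) / Real.sqrt n else 0) ≤ certEvenDvd6.wbar n := by
  intro n hn
  have hn8 : n < 8 := by simpa [show certEvenDvd6.N = 7 from rfl] using Finset.mem_range.1 hn
  have hw := wbar7_ge 7 le_rfl n (Finset.mem_range.2 hn8)
  unfold JointCert.wbar
  rw [show certEvenDvd6.D = 1048576 from rfl]
  interval_cases n
  · rw [if_neg (by decide), show certEvenDvd6.weights.getD 0 0 = 0 from rfl]
    norm_num
  · rw [if_pos (by decide), show certEvenDvd6.weights.getD 1 0 = 0 from rfl]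
    exact hw.trans (by norm_num [wbar7])
  · rw [if_neg (by decide), show certEvenDvd6.weights.getD 2 0 = 0 from rfl]
    norm_num
  · rw [if_neg (by decide), show certEvenDvd6.weights.getD 3 0 = 0 from rfl]
    norm_num
  · rw [if_neg (by decide), show certEvenDvd6.weights.getD 4 0 = 0 from rfl]
    norm_num
  · rw [if_pos (by decide), show certEvenDvd6.weights.getD 5 0 = 754726 from rfl]
    exact hw.trans (by norm_num [wbar7])
  · rw [if_neg (by decide), show certEvenDvd6.weights.getD 6 0 = 0 from rfl]
    norm_num
  · rw [if_pos (by decide), show certEvenDvd6.weights.getD 7 0 = 771213 from rfl]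
    exact hw.trans (by norm_num [wbar7])

/-- The weights of `certOddDvd6` dominate `Λ(n)/√n` on the `n ≤ 7` prime to `6` (`W_n = ⌈2^20 w̄_n⌉`, `UniformFloor.wbar7_ge`);
the other weights are `0`. [folklore] -/
theorem certOddDvd6_hw : ∀ n ∈ Finset.range (certOddDvd6.N + 1),
    (if n.Coprime 6 then (Λ n : ℝ) / Real.sqrt n else 0) ≤ certOddDvd6.wbar n := by
  intro n hn
  have hn8 : n < 8 := by simpa [show certOddDvd6.N = 7 from rfl] using Finset.mem_range.1 hn
  have hw := wbar7_ge 7 le_rfl n (Finset.mem_range.2 hn8)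
  unfold JointCert.wbar
  rw [show certOddDvd6.D = 1048576 from rfl]
  interval_cases n
  · rw [if_neg (by decide), show certOddDvd6.weights.getD 0 0 = 0 from rfl]
    norm_num
  · rw [if_pos (by decide), show certOddDvd6.weights.getD 1 0 = 0 from rfl]
    exact hw.trans (by norm_num [wbar7])
  · rw [if_neg (by decide), show certOddDvd6.weights.getD 2 0 = 0 from rfl]
    norm_num
  · rw [if_neg (by decide), show certOddDvd6.weights.getD 3 0 = 0 from rfl]
    norm_num
  · rw [if_neg (by decide), show certOddDvd6.weights.getD 4 0 = 0 from rfl]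
    norm_num
  · rw [if_pos (by decide), show certOddDvd6.weights.getD 5 0 = 754726 from rfl]
    exact hw.trans (by norm_num [wbar7])
  · rw [if_neg (by decide), show certOddDvd6.weights.getD 6 0 = 0 from rfl]
    norm_num
  · rw [if_pos (by decide), show certOddDvd6.weights.getD 7 0 = 771213 from rfl]
    exact hw.trans (by norm_num [wbar7])

/-- `log 34 ≥ 2 log 2 + 2 log 3 − 1/17` (`34 = 36·(34/36)`, `log x ≤ x − 1`). [folklore] -/
theorem log_34_ge : 2 * Real.log 2 + 2 * Real.log 3 - 1 / 17 ≤ Real.log 34 := by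
  have hl : Real.log ((36 : ℝ) / 34) ≤ 36 / 34 - 1 := Real.log_le_sub_one_of_pos (by norm_num)
  have h36 : Real.log (36 : ℝ) = 2 * Real.log 2 + 2 * Real.log 3 := by
    rw [show (36 : ℝ) = 2 ^ 2 * 3 ^ 2 by norm_num, Real.log_mul (by norm_num) (by norm_num), Real.log_pow, Real.log_pow]
    push_cast
    ring
  rw [Real.log_div (by norm_num) (by norm_num), h36] at hl
  linarith

/-- `log 14 ≥ 4 log 2 − 1/7` (`14 = 16·(14/16)`). [folklore] -/
theorem log_14_ge : 4 * Real.log 2 - 1 / 7 ≤ Real.log 14 := by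
  have hl : Real.log ((16 : ℝ) / 14) ≤ 16 / 14 - 1 := Real.log_le_sub_one_of_pos (by norm_num)
  rw [Real.log_div (by norm_num) (by norm_num), show (16 : ℝ) = 2 ^ 4 by norm_num, Real.log_pow] at hl
  push_cast at hl
  linarith

/-- `log 45 ≥ 4 log 2 + log 3 − 1/15` (`45 = 48·(45/48)`). [folklore] -/
theorem log_45_ge : 4 * Real.log 2 + Real.log 3 - 1 / 15 ≤ Real.log 45 := by
  have hl : Real.log ((48 : ℝ) / 45) ≤ 48 / 45 - 1 := Real.log_le_sub_one_of_pos (by norm_num)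
  have h48 : Real.log (48 : ℝ) = 4 * Real.log 2 + Real.log 3 := by
    rw [show (48 : ℝ) = 2 ^ 4 * 3 by norm_num, Real.log_mul (by norm_num) (by norm_num), Real.log_pow]
    push_cast
    ring
  rw [Real.log_div (by norm_num) (by norm_num), h48] at hl
  linarith

/-- `log 24 = 3 log 2 + log 3`. [folklore] -/
theorem log_24_eq : Real.log 24 = 3 * Real.log 2 + Real.log 3 := by
  rw [show (24 : ℝ) = 2 ^ 3 * 3 by norm_num, Real.log_mul (by norm_num) (by norm_num), Real.log_pow]
  push_cast
  ring

/-- The budget of `certEvenDvd2`: `log π − (-4.22745354) − Clow/D + RHO/D ≤ log 34` (`= 3.500710 ≤ 3.526361`). [folklore] -/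
theorem certEvenDvd2_budget :
    Real.log Real.pi - (-4.22745354) - (certEvenDvd2.Clow : ℝ) / certEvenDvd2.D + (certEvenDvd2.RHO : ℝ) / certEvenDvd2.D ≤
      Real.log (34 : ℕ) := by
  have hπ := Literature.Analysis.SpecialFunctions.Real.log_pi_le
  have h2 := Real.log_two_gt_d9
  have h3 := Real.log_three_gt_d9
  have hQ := log_34_ge
  rw [show certEvenDvd2.Clow = 7676640 from rfl, show certEvenDvd2.D = 1048576 from rfl,
    show certEvenDvd2.RHO = 5714258 from rfl]
  push_cast
  linarith

/-- The budget of `certOddDvd2`: `log π − (-1.08586154) − Clow/D + RHO/D ≤ log 14` (`= 2.580291 ≤ 2.639057`). [folklore] -/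
theorem certOddDvd2_budget :
    Real.log Real.pi - (-1.08586154) - (certOddDvd2.Clow : ℝ) / certOddDvd2.D + (certOddDvd2.RHO : ℝ) / certOddDvd2.D ≤
      Real.log (14 : ℕ) := by
  have hπ := Literature.Analysis.SpecialFunctions.Real.log_pi_le
  have h2 := Real.log_two_gt_d9
  have hQ := log_14_ge
  rw [show certOddDvd2.Clow = 4399980 from rfl, show certOddDvd2.D = 1048576 from rfl,
    show certOddDvd2.RHO = 4766667 from rfl]
  push_cast
  linarith

/-- The budget of `certEvenDvd3`: `log π − (-4.22745354) − Clow/D + RHO/D ≤ log 45` (`= 3.777208 ≤ 3.806662`). [folklore] -/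
theorem certEvenDvd3_budget :
    Real.log Real.pi - (-4.22745354) - (certEvenDvd3.Clow : ℝ) / certEvenDvd3.D + (certEvenDvd3.RHO : ℝ) / certEvenDvd3.D ≤
      Real.log (45 : ℕ) := by
  have hπ := Literature.Analysis.SpecialFunctions.Real.log_pi_le
  have h2 := Real.log_two_gt_d9
  have h3 := Real.log_three_gt_d9
  have hQ := log_45_ge
  rw [show certEvenDvd3.Clow = 7676640 from rfl, show certEvenDvd3.D = 1048576 from rfl,
    show certEvenDvd3.RHO = 6004187 from rfl]
  push_cast
  linarith

/-- The budget of `certOddDvd3`: `log π − (-1.08586154) − Clow/D + RHO/D ≤ log 18` (`= 2.851104 ≤ 2.890372`). [folklore] -/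
theorem certOddDvd3_budget :
    Real.log Real.pi - (-1.08586154) - (certOddDvd3.Clow : ℝ) / certOddDvd3.D + (certOddDvd3.RHO : ℝ) / certOddDvd3.D ≤
      Real.log (18 : ℕ) := by
  have hπ := Literature.Analysis.SpecialFunctions.Real.log_pi_le
  have h2 := Real.log_two_gt_d9
  have h3 := Real.log_three_gt_d9
  have hQ : Real.log 18 = Real.log 2 + 2 * Real.log 3 := by
    rw [show (18 : ℝ) = 2 * 3 ^ 2 by norm_num, Real.log_mul (by norm_num) (by norm_num), Real.log_pow]
    push_cast
    ring
  rw [show certOddDvd3.Clow = 4399980 from rfl, show certOddDvd3.D = 1048576 from rfl,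
    show certOddDvd3.RHO = 5050635 from rfl]
  push_cast
  linarith

/-- The budget of `certEvenDvd6`: `log π − (-4.22745354) − Clow/D + RHO/D ≤ log 24` (`= 2.913775 ≤ 3.178054`). [folklore] -/
theorem certEvenDvd6_budget :
    Real.log Real.pi - (-4.22745354) - (certEvenDvd6.Clow : ℝ) / certEvenDvd6.D + (certEvenDvd6.RHO : ℝ) / certEvenDvd6.D ≤
      Real.log (24 : ℕ) := by
  have hπ := Literature.Analysis.SpecialFunctions.Real.log_pi_le
  have h2 := Real.log_two_gt_d9
  have h3 := Real.log_three_gt_d9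
  have hQ := log_24_eq
  rw [show certEvenDvd6.Clow = 7676640 from rfl, show certEvenDvd6.D = 1048576 from rfl,
    show certEvenDvd6.RHO = 5098812 from rfl]
  push_cast
  linarith

/-- The budget of `certOddDvd6`: `log π − (-1.08586154) − Clow/D + RHO/D ≤ log 12` (`= 1.990975 ≤ 2.484907`). [folklore] -/
theorem certOddDvd6_budget :
    Real.log Real.pi - (-1.08586154) - (certOddDvd6.Clow : ℝ) / certOddDvd6.D + (certOddDvd6.RHO : ℝ) / certOddDvd6.D ≤
      Real.log (12 : ℕ) := by
  have hπ := Literature.Analysis.SpecialFunctions.Real.log_pi_le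
  have h2 := Real.log_two_gt_d9
  have h3 := Real.log_three_gt_d9
  have hQ : Real.log 12 = 2 * Real.log 2 + Real.log 3 := by
    rw [show (12 : ℝ) = 2 ^ 2 * 3 by norm_num, Real.log_mul (by norm_num) (by norm_num), Real.log_pow]
    push_cast
    ring
  rw [show certOddDvd6.Clow = 4399980 from rfl, show certOddDvd6.D = 1048576 from rfl,
    show certOddDvd6.RHO = 4148724 from rfl]
  push_cast
  linarith

end UniformFloor

end Summit.Ventures.WeilGRH

end
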